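import Summits.CriticalPhenomena.PercolationContinuityZ3.Theorems.PercShatteringRaceNearLinearTwoClusterDecayStubRelayChainAux
import HarnessLib

/-!
# Crux `PercShatteringRace.NearLinearTwoClusterDecay` (stmt-CriticalPhenomena-5785) — engine stub E2 `stub_relayChain`

Helper file of the line `pair-decay-long-arms-dense` (lead c5); lands with `--supports stmt-CriticalPhenomena-5785`
(registered stub `stub_relayChain` of skeleton rev L5-c5). The deterministic geometry / event inclusion and the
two real-analysis lemmas are in the auxiliary file `PercShatteringRaceNearLinearTwoClusterDecayStubRelayChainAux.lean`
(registered auxiliary stub `stub_relayChainAux`).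

## Statement

`stub_relayChain` (the occupation-rate RELAY, bond percolation on `ℤ³` at `p = p_c`): let `σ > 0`, `A ≥ 1`,
`ζ > 0`, `γ ≤ 1` with `γ(1+σ) > 1` and `γ(1+ζ) > 1`. Assume, in the jump world `θ(p_c) > 0`,
* `OccRate σ`: `P(Λ_u misses every infinite cluster) ≤ C₁ u^{-σ}` for all `u ≥ 1`;
* `TwoClusterRate A ζ`: `P((uniqZone u ⌈u^A⌉)ᶜ) ≤ C₂ u^{-ζ}` for all large `u`.
Then for every aspect `x > max 1 (γA)` there is `δ > 0` (namely `θ(p_c)²/2`) such that for all large `u`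
and all `a, b ∈ Λ_u`, `P(a ↔ b inside Λ_{⌈u^x⌉}) ≥ δ` ("pair long-range order at aspect `x`").

## Proof sketch (Cerf 2015, §10: the proof of Theorem 1.3 from Lemma 10.1, with relays)

Fix large `u`, `a, b ∈ Λ_u`; relay radius `r = ⌈u^γ⌉₊`, `M = ⌈(2r)^A⌉₊`, `N = ⌈u^x⌉₊`, and relay centres
`z 0 = a, …, z J = b` in `Λ_u` (`J = 2u/r + 1`) with steps `≤ r` (`exists_relayCentres`).
* Harris–FKG (`harris_fkg_holds`) and translation invariance (`theta_zdGraph_eq_theta_zero`):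
  `P(a ⇝ ∞, b ⇝ ∞) ≥ θ²`.
* On `{a ⇝ ∞} ∩ {b ⇝ ∞}`, outside the bad events `Bad j = (ω ↦ ω - z j)⁻¹' (Miss ∪ (uniqZone (2r) M)ᶜ)`
  (`Miss = {Λ_r misses every infinite cluster}`, `j ≤ J`), the relay chain joins `a` to `b` inside `Λ_N`
  (`mem_openConnIn_of_relay`: consecutive infinite strands meet `z j + Λ_{2r}`, reach `∂(z j + Λ_M)` by first
  exit, are glued by the translated uniqueness zone inside `z j + Λ_M ⊆ Λ_N` since `u + M ≤ N` eventually,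
  as `x > 1`, `x > γA`). Inclusion up to the null set of non-lattice configurations
  (`DCT16.real_mono_of_forall_subset_edgeSet`) and a union bound.
* Translation invariance (`bondPercolation_real_preimage_shift`): `P(Bad j) = P(Miss) + P((uniqZone (2r) M)ᶜ)`
  `≤ C₁ r^{-σ} + C₂ (2r)^{-ζ} ≤ C₁ u^{-γσ} + C₂ u^{-γζ}`, and `J + 1 ≤ 2u^{1-γ} + 2`; since `1 - γ(1+σ) < 0` and
  `1 - γ(1+ζ) < 0`, `(J+1) P(Bad) ≤ θ²/2` eventually, whence `P(a ↔ b in Λ_N) ≥ θ² - θ²/2`.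

## References

* R. Cerf, *A lower bound on the two-arms exponent for critical percolation on the lattice*, Ann. Probab. 43
  (2015) 2458–2480, arXiv:1306.3105, Lemma 10.1 and §10 [Cerf2015].
* S. Martineau, V. Tassion, Ann. Probab. 45 (2017), proof of Lemma 3.7 (uniqueness zone) [MartineauTassion2017].
* G. Grimmett, *Percolation*, 2nd ed., Springer 1999, §1.6, §2.2 (Harris–FKG) [GrimmettPercolation1999].
-/

noncomputable section

namespace Summit.CriticalPhenomena.PercolationContinuityZ3.Theorems

namespace NearLinearTwoClusterDecayRelayChain

open MeasureTheory Filter Topology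
open Literature.Probability.LatticeModels Literature.Probability.Percolation

/-- **Harris–FKG for two infinite strands**: `θ(p)² ≤ P_p(a ⇝ ∞, b ⇝ ∞)` on `ℤ³`, by positive association of
the increasing events `{|C(a)| = ∞}`, `{|C(b)| = ∞}` and translation invariance `θ_a = θ_b = θ_0`.
[cite: Cerf2015, Lemma 10.1] -/
theorem theta_sq_le_real_inter_percolatesAt (p : unitInterval) (a b : Site 3) :
    theta (zdGraph 3) 0 p ^ 2 ≤ (bondPercolation (zdGraph 3) p).real (percolatesAt a ∩ percolatesAt b) := by
  have h := harris_fkg_holds (zdGraph 3) p (isUpperSet_percolatesAt a) (isUpperSet_percolatesAt b)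
    (measurableSet_percolatesAt_holds a) (measurableSet_percolatesAt_holds b)
  have hθa : (bondPercolation (zdGraph 3) p).real (percolatesAt a) = theta (zdGraph 3) 0 p :=
    theta_zdGraph_eq_theta_zero p a
  have hθb : (bondPercolation (zdGraph 3) p).real (percolatesAt b) = theta (zdGraph 3) 0 p :=
    theta_zdGraph_eq_theta_zero p b
  calc theta (zdGraph 3) 0 p ^ 2
      = (bondPercolation (zdGraph 3) p).real (percolatesAt a) *
          (bondPercolation (zdGraph 3) p).real (percolatesAt b) := by rw [hθa, hθb, sq]
    _ ≤ _ := h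

/-- **Outside the bad events the relay works** (pointwise form used under
`DCT16.real_mono_of_forall_subset_edgeSet`): for a lattice configuration in `{z 0 ⇝ ∞} ∩ {z J ⇝ ∞}` that avoids
every `Bad j = (ω ↦ ω - z j)⁻¹' ({Λ_r misses C_∞} ∪ (uniqZone (2r) M)ᶜ)`, `j ≤ J`, the endpoints are joined
inside `Λ_N`. [cite: Cerf2015, §10 (proof of Theorem 1.3)] -/
theorem mem_openConnIn_or_bad {u r M N J : ℕ} (hrM : 2 * r ≤ M) (hMN : u + M ≤ N) {z : ℕ → Site 3}
    (hzbox : ∀ j, z j ∈ box 3 u) (hzstep : ∀ j, z (j + 1) ∈ GM.ball (z j) r) {ω : BondConfig (Site 3)}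
    (hω : ω ⊆ (zdGraph 3).edgeSet) (hab : ω ∈ (percolatesAt (z 0) ∩ percolatesAt (z J) : Set _)) :
    ω ∈ openConnIn (↑(box 3 N) : Set (Site 3)) (z 0) (z J) ∪
      ⋃ j ∈ Finset.range (J + 1), BondConfig.relabel (sym2Equiv (Site.shift (-(z j)))) ⁻¹'
        ({ω | ∀ y ∈ box 3 r, ω ∉ percolatesAt y} ∪ (@uniqZone 3 (2 * r) M)ᶜ) := by
  by_cases hbad : ∃ j ∈ Finset.range (J + 1), ω ∈ BondConfig.relabel (sym2Equiv (Site.shift (-(z j)))) ⁻¹'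
      ({ω | ∀ y ∈ box 3 r, ω ∉ percolatesAt y} ∪ (@uniqZone 3 (2 * r) M)ᶜ)
  · refine Or.inr ?_
    simp only [Set.mem_iUnion, exists_prop]
    exact hbad
  push Not at hbad
  refine Or.inl (mem_openConnIn_of_relay hrM hMN hzbox hzstep hω hab.1 hab.2 ?_ ?_)
  · intro j hj
    have h := hbad j (Finset.mem_range.2 (Nat.lt_succ_of_le hj))
    have h1 : ∃ y ∈ box 3 r, BondConfig.relabel (sym2Equiv (Site.shift (-(z j)))) ω ∈ percolatesAt y := by
      by_contra hc
      push Not at hc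
      exact h (Or.inl hc)
    obtain ⟨y, hy, hyp⟩ := h1
    refine ⟨y + z j, ?_, ?_⟩
    · rw [GM.mem_ball]
      rw [mem_box] at hy
      intro i
      have := hy i
      simp only [Pi.add_apply]
      constructor <;> omega
    · have h' : ω ∈ BondConfig.relabel (sym2Equiv (Site.shift (-(z j)))) ⁻¹'
          percolatesAt (y + z j + -(z j)) := by
        rw [add_neg_cancel_right]
        exact hyp
      rwa [preimage_relabel_shift_percolatesAt] at h'
  · intro j hj
    have h := hbad j (Finset.mem_range.2 (Nat.lt_succ_of_le hj))
    by_contra hc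
    exact h (Or.inr hc)

end NearLinearTwoClusterDecayRelayChain

open MeasureTheory Filter Topology
open Literature.Probability.LatticeModels Literature.Probability.Percolation
open NearLinearTwoClusterDecayRelayChain

/-- **Engine stub E2 `stub_relayChain` of the line `pair-decay-long-arms-dense`** (registered): the occupation-rate
relay — in the jump world, an occupation rate `σ` for boxes meeting `C_∞` and a two-cluster rate `ζ` at aspect `A`
give pair long-range order at every aspect `x > max 1 (γA)` once `γ(1+σ) > 1`, `γ(1+ζ) > 1`, `γ ≤ 1`.
[cite: Cerf2015, Lemma 10.1] -/
theorem stub_relayChain :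
    ∀ σ A ζ γ : ℝ, 0 < σ → 1 ≤ A → 0 < ζ → 1 / (1 + σ) < γ → 1 / (1 + ζ) < γ → γ ≤ 1 →
    (0 < theta (zdGraph 3) 0 (criticalProbI 3) → ∃ C : ℝ, ∀ u : ℕ, 1 ≤ u →
      (bondPercolation (zdGraph 3) (criticalProbI 3)).real
        {ω | ∀ x ∈ box 3 u, ω ∉ percolatesAt x} ≤ C * (u : ℝ) ^ (-σ)) →
    (0 < theta (zdGraph 3) 0 (criticalProbI 3) → ∃ C : ℝ, ∀ᶠ u : ℕ in atTop,
      (bondPercolation (zdGraph 3) (criticalProbI 3)).real (@uniqZone 3 u ⌈(u : ℝ) ^ A⌉₊)ᶜ ≤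
        C * (u : ℝ) ^ (-ζ)) →
    ∀ x : ℝ, max 1 (γ * A) < x →
    (0 < theta (zdGraph 3) 0 (criticalProbI 3) → ∃ δ : ℝ, 0 < δ ∧ ∀ᶠ u : ℕ in atTop,
      ∀ a ∈ box 3 u, ∀ b ∈ box 3 u,
        δ ≤ (bondPercolation (zdGraph 3) (criticalProbI 3)).real
          (openConnIn (↑(box 3 ⌈(u : ℝ) ^ x⌉₊) : Set (Site 3)) a b)) := by
  intro σ A ζ γ hσ hA hζ hγσ hγζ _hγ1 hOcc hTwo x hx hθ
  set μ := bondPercolation (zdGraph 3) (criticalProbI 3) with hμ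
  set θ := theta (zdGraph 3) 0 (criticalProbI 3) with hθdef
  obtain ⟨C₁, hC₁⟩ := hOcc hθ
  obtain ⟨C₂, hC₂⟩ := hTwo hθ
  obtain ⟨N₂, hN₂⟩ := Filter.eventually_atTop.1 hC₂
  set C₁' := max C₁ 0 with hC₁'
  set C₂' := max C₂ 0 with hC₂'
  have hC₁'0 : 0 ≤ C₁' := le_max_right _ _
  have hC₂'0 : 0 ≤ C₂' := le_max_right _ _
  -- exponents
  have hγpos : 0 < γ := lt_trans (by positivity) hγσ
  have h1x : 1 < x := lt_of_le_of_lt (le_max_left _ _) hx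
  have hγAx : γ * A < x := lt_of_le_of_lt (le_max_right _ _) hx
  have h0x : (0 : ℝ) < x := zero_lt_one.trans h1x
  have hγσ' : 1 < γ * (1 + σ) := (div_lt_iff₀ (by linarith)).1 hγσ
  have hγζ' : 1 < γ * (1 + ζ) := (div_lt_iff₀ (by linarith)).1 hγζ
  have he1 : (1 - γ) + γ * (-σ) < 0 := by nlinarith
  have he2 : (1 - γ) + γ * (-ζ) < 0 := by nlinarith
  have he3 : γ * (-σ) < 0 := by nlinarith
  have he4 : γ * (-ζ) < 0 := by nlinarith
  have hθ8 : 0 < θ ^ 2 / 8 := by positivity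
  have hT : Tendsto (fun u : ℕ => (u : ℝ) ^ γ) atTop atTop :=
    (tendsto_rpow_atTop hγpos).comp tendsto_natCast_atTop_atTop
  refine ⟨θ ^ 2 / 2, by positivity, ?_⟩
  filter_upwards [eventually_ge_atTop 1, hT.eventually_ge_atTop (N₂ : ℝ),
    eventually_mul_rpow_le_rpow_div_three 1 h1x, eventually_mul_rpow_le_rpow_div_three ((4 : ℝ) ^ A) hγAx,
    eventually_mul_rpow_le_rpow_div_three 1 h0x, eventually_mul_rpow_le_of_neg (2 * C₁') he1 hθ8,
    eventually_mul_rpow_le_of_neg (2 * C₂') he2 hθ8, eventually_mul_rpow_le_of_neg (2 * C₁') he3 hθ8,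
    eventually_mul_rpow_le_of_neg (2 * C₂') he4 hθ8] with u hu1 huN h1 h2 h3 h4 h5 h6 h7
  intro a ha b hb
  have hu0 : (0 : ℝ) < u := by exact_mod_cast hu1
  have huγ1 : 1 ≤ (u : ℝ) ^ γ := Real.one_le_rpow (by exact_mod_cast hu1) hγpos.le
  -- the relay radius
  set r := ⌈(u : ℝ) ^ γ⌉₊ with hr
  have hur : (u : ℝ) ^ γ ≤ r := Nat.le_ceil _
  have hr1 : 1 ≤ r := by
    have : (1 : ℝ) ≤ r := huγ1.trans hur
    exact_mod_cast this
  have hr0 : (0 : ℝ) < r := by exact_mod_cast hr1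
  have hr2 : (r : ℝ) ≤ 2 * (u : ℝ) ^ γ := by
    have : (r : ℝ) < (u : ℝ) ^ γ + 1 := Nat.ceil_lt_add_one (Real.rpow_nonneg hu0.le γ)
    linarith
  set M := ⌈((2 * r : ℕ) : ℝ) ^ A⌉₊ with hM
  set N := ⌈(u : ℝ) ^ x⌉₊ with hN
  set J := 2 * u / r + 1 with hJ
  have hrM : 2 * r ≤ M := le_nat_ceil_rpow hA (2 * r)
  -- `u + M ≤ N`
  have hMN : u + M ≤ N := by
    have h2r0 : (0 : ℝ) ≤ ((2 * r : ℕ) : ℝ) := Nat.cast_nonneg _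
    have hM1 : (M : ℝ) < ((2 * r : ℕ) : ℝ) ^ A + 1 := Nat.ceil_lt_add_one (Real.rpow_nonneg h2r0 A)
    have h2r : ((2 * r : ℕ) : ℝ) ≤ 4 * (u : ℝ) ^ γ := by push_cast; linarith
    have hpow : ((2 * r : ℕ) : ℝ) ^ A ≤ (4 : ℝ) ^ A * (u : ℝ) ^ (γ * A) := by
      calc ((2 * r : ℕ) : ℝ) ^ A ≤ (4 * (u : ℝ) ^ γ) ^ A := Real.rpow_le_rpow h2r0 h2r (by linarith)
        _ = (4 : ℝ) ^ A * ((u : ℝ) ^ γ) ^ A := Real.mul_rpow (by norm_num) (Real.rpow_nonneg hu0.le γ)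
        _ = (4 : ℝ) ^ A * (u : ℝ) ^ (γ * A) := by rw [Real.rpow_mul hu0.le]
    rw [Real.rpow_one, one_mul] at h1
    rw [Real.rpow_zero, one_mul] at h3
    have hNx : (u : ℝ) ^ x ≤ N := Nat.le_ceil _
    have : ((u + M : ℕ) : ℝ) < (N : ℝ) := by push_cast; linarith
    exact_mod_cast this.le
  -- the relay centres
  obtain ⟨z, hz0, hzJ, hzbox, hzstep⟩ := exists_relayCentres u r hr1 ha hb
  have hzJ' : z J = b := hzJ J le_rfl
  -- the events
  set E : Set (BondConfig (Site 3)) := {ω | ∀ y ∈ box 3 r, ω ∉ percolatesAt y} ∪ (@uniqZone 3 (2 * r) M)ᶜ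
    with hE
  set S : Set (Site 3) := ↑(box 3 N) with hS
  -- Harris–FKG, inclusion and union bound
  have hfkg : θ ^ 2 ≤ μ.real (percolatesAt a ∩ percolatesAt b) :=
    theta_sq_le_real_inter_percolatesAt (criticalProbI 3) a b
  have hincl : μ.real (percolatesAt a ∩ percolatesAt b) ≤ μ.real (openConnIn S a b ∪
      ⋃ j ∈ Finset.range (J + 1), BondConfig.relabel (sym2Equiv (Site.shift (-(z j)))) ⁻¹' E) := by
    refine DCT16.real_mono_of_forall_subset_edgeSet (zdGraph 3) (criticalProbI 3) fun ω hω hab => ?_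
    have h := mem_openConnIn_or_bad (J := J) hrM hMN hzbox hzstep hω (by rw [hz0, hzJ']; exact hab)
    rwa [hz0, hzJ'] at h
  have hunion : μ.real (openConnIn S a b ∪
      ⋃ j ∈ Finset.range (J + 1), BondConfig.relabel (sym2Equiv (Site.shift (-(z j)))) ⁻¹' E) ≤
      μ.real (openConnIn S a b) +
        ∑ j ∈ Finset.range (J + 1), μ.real (BondConfig.relabel (sym2Equiv (Site.shift (-(z j)))) ⁻¹' E) :=
    (measureReal_union_le _ _).trans (add_le_add le_rfl (measureReal_biUnion_finset_le _ _))
  have hsum : ∑ j ∈ Finset.range (J + 1), μ.real (BondConfig.relabel (sym2Equiv (Site.shift (-(z j)))) ⁻¹' E) =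
      ((J : ℝ) + 1) * μ.real E := by
    rw [Finset.sum_congr rfl fun j _ => bondPercolation_real_preimage_shift (-(z j)) (criticalProbI 3) E,
      Finset.sum_const, Finset.card_range, nsmul_eq_mul]
    push_cast
    ring
  -- the probability of one bad event
  have hE1 : μ.real E ≤ C₁' * (u : ℝ) ^ (γ * (-σ)) + C₂' * (u : ℝ) ^ (γ * (-ζ)) := by
    have hocc_r : μ.real {ω | ∀ y ∈ box 3 r, ω ∉ percolatesAt y} ≤ C₁ * (r : ℝ) ^ (-σ) := hC₁ r hr1
    have h2rN : N₂ ≤ 2 * r := by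
      have : (N₂ : ℝ) ≤ ((2 * r : ℕ) : ℝ) := by push_cast; linarith
      exact_mod_cast this
    have huz : μ.real (@uniqZone 3 (2 * r) M)ᶜ ≤ C₂ * ((2 * r : ℕ) : ℝ) ^ (-ζ) := hN₂ (2 * r) h2rN
    have hrpow1 : (r : ℝ) ^ (-σ) ≤ (u : ℝ) ^ (γ * (-σ)) := by
      rw [Real.rpow_mul hu0.le]
      exact Real.rpow_le_rpow_of_nonpos (Real.rpow_pos_of_pos hu0 γ) hur (by linarith)
    have hrpow2 : ((2 * r : ℕ) : ℝ) ^ (-ζ) ≤ (u : ℝ) ^ (γ * (-ζ)) := by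
      rw [Real.rpow_mul hu0.le]
      exact Real.rpow_le_rpow_of_nonpos (Real.rpow_pos_of_pos hu0 γ) (by push_cast; linarith) (by linarith)
    calc μ.real E ≤ μ.real {ω | ∀ y ∈ box 3 r, ω ∉ percolatesAt y} + μ.real (@uniqZone 3 (2 * r) M)ᶜ :=
          measureReal_union_le _ _
      _ ≤ C₁ * (r : ℝ) ^ (-σ) + C₂ * ((2 * r : ℕ) : ℝ) ^ (-ζ) := add_le_add hocc_r huz
      _ ≤ C₁' * (r : ℝ) ^ (-σ) + C₂' * ((2 * r : ℕ) : ℝ) ^ (-ζ) :=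
          add_le_add (mul_le_mul_of_nonneg_right (le_max_left _ _) (Real.rpow_nonneg hr0.le _))
            (mul_le_mul_of_nonneg_right (le_max_left _ _) (Real.rpow_nonneg (Nat.cast_nonneg _) _))
      _ ≤ C₁' * (u : ℝ) ^ (γ * (-σ)) + C₂' * (u : ℝ) ^ (γ * (-ζ)) :=
          add_le_add (mul_le_mul_of_nonneg_left hrpow1 hC₁'0) (mul_le_mul_of_nonneg_left hrpow2 hC₂'0)
  -- the number of relays
  have hJ1 : (J : ℝ) + 1 ≤ 2 * (u : ℝ) ^ (1 - γ) + 2 := by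
    have hdiv : ((2 * u / r : ℕ) : ℝ) ≤ (2 * u : ℝ) / r := by
      have h := Nat.cast_div_le (m := 2 * u) (n := r) (α := ℝ)
      push_cast at h
      exact h
    have hdiv2 : (2 * u : ℝ) / r ≤ 2 * (u : ℝ) ^ (1 - γ) := by
      rw [div_le_iff₀ hr0]
      have hsplit : (u : ℝ) = (u : ℝ) ^ (1 - γ) * (u : ℝ) ^ γ := by
        rw [← Real.rpow_add hu0, sub_add_cancel, Real.rpow_one]
      have h' : (u : ℝ) ^ (1 - γ) * (u : ℝ) ^ γ ≤ (u : ℝ) ^ (1 - γ) * r :=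
        mul_le_mul_of_nonneg_left hur (Real.rpow_nonneg hu0.le _)
      linarith
    have hJc : (J : ℝ) = ((2 * u / r : ℕ) : ℝ) + 1 := by rw [hJ]; push_cast; ring
    linarith
  -- the union bound is small
  have hprod : ((J : ℝ) + 1) * μ.real E ≤ θ ^ 2 / 2 := by
    calc ((J : ℝ) + 1) * μ.real E
        ≤ (2 * (u : ℝ) ^ (1 - γ) + 2) * (C₁' * (u : ℝ) ^ (γ * (-σ)) + C₂' * (u : ℝ) ^ (γ * (-ζ))) :=
          mul_le_mul hJ1 hE1 measureReal_nonneg (by positivity)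
      _ = 2 * C₁' * (u : ℝ) ^ ((1 - γ) + γ * (-σ)) + 2 * C₂' * (u : ℝ) ^ ((1 - γ) + γ * (-ζ)) +
            2 * C₁' * (u : ℝ) ^ (γ * (-σ)) + 2 * C₂' * (u : ℝ) ^ (γ * (-ζ)) := by
          rw [Real.rpow_add hu0, Real.rpow_add hu0]; ring
      _ ≤ θ ^ 2 / 8 + θ ^ 2 / 8 + θ ^ 2 / 8 + θ ^ 2 / 8 := add_le_add (add_le_add (add_le_add h4 h5) h6) h7
      _ = θ ^ 2 / 2 := by ring
  linarith [hfkg, hincl, hunion, hsum, hprod]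

end Summit.CriticalPhenomena.PercolationContinuityZ3.Theorems
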